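import Summits.PneNP.PneNP.Theorems.ClusUniversalCertificateCoordInv
import Summits.PneNP.PneNP.Theses.ClusUniversalCertificate
import Mathlib
import HarnessLib

/-!
# Route ClusUniversalCertificate — path `coord` on the crux `UniversalCertAll` (stmt-PneNP-19683): transfer from mixed blocks to the crux
(rung F-N1, cell pnp-ideate, planner p1 g6; registered skeleton HOME/pnp-ideate-p1/lines/layer.lean v6 sha16 ed80fa781593c29a, path `coord`;
stub `stub_transfer`, M, WANTED for provers on STATUS 08:49Z)

The registered stub `stub_transfer` of p1's path `coord`, BY NAME: the mixed-block certificate in every total dimension (`∀ M, UCMixDim M`, the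
output of the path's induction `ClusCoord.ucMixDim_all`) implies the route's crux `Summit.PneNP.PneNP.Theses.ClusUniversalCertificate.UniversalCertAll`
(constant block size `m`).  This file imports the route file because the stub's conclusion IS the route decl (disclosed; the objects live in the
route-independent `ClusUniversalCertificateCoordDefs.lean`).

PROOF (transport, no mathematics beyond bookkeeping).  Uncurry `φ : (Fin n → Fin m → 𝔽₂) ≃ₗ (Fin (n·m) → 𝔽₂)` along `finProdFinEquiv`, with the block
map `blk idx = (finProdFinEquiv.symm idx).1`.  Then every block has `bsize = m`, the zero counts of `φ(Y)` are the crux's `#{y ∈ Y : y_k = 0}`, flats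
inside `Y` push forward along `φ` with their dimension (`ClusCoord.sInf_flatCodim_image_le`, so `acodim (φ Y) (φ y) ≤ codim_Y(y)`), and the sum over
`φ(Y)` re-indexes over `Y`; the mixed certificate `UCMix (n·m) n blk (φ Y)` is then literally the crux's inequality for `(n, m, Y)`, up to these
identifications.

HONEST FRAMING: ONE registered M-sized stub (transport) of an OPEN crux of route ClusUniversalCertificate; its hypothesis `∀ M, UCMixDim M` is NOT
proved (the path's load-bearing stub `stub_cllZeroRare` is OPEN and XL); FRONTIER rung F-N1 — nothing here bears on P vs NP.
-/

set_option linter.dupNamespace false -- `Summit.PneNP.PneNP.…`: summit = sub-problem name (D-0017 single-conjunct layout)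

namespace Summit.PneNP.PneNP.Theorems.ClusCoord

open Finset

/-- **Registered stub `stub_transfer`** of the path `coord` (stmt-PneNP-19683), BY NAME: the mixed-block certificate in every total dimension
gives the crux `UniversalCertAll` (constant block size). -/
theorem stub_transfer : (∀ M : ℕ, UCMixDim M) → Summit.PneNP.PneNP.Theses.ClusUniversalCertificate.UniversalCertAll := by
  intro h n m Y
  classical
  -- the uncurrying equivalence and the block map
  let e : Fin n × Fin m ≃ Fin (n * m) := finProdFinEquiv
  let φ : (Fin n → Fin m → ZMod 2) ≃ₗ[ZMod 2] (Fin (n * m) → ZMod 2) :=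
    (LinearEquiv.curry (ZMod 2) (ZMod 2) (Fin n) (Fin m)).symm ≪≫ₗ
      LinearEquiv.funCongrLeft (ZMod 2) (ZMod 2) e.symm
  have hφ : ∀ (y : Fin n → Fin m → ZMod 2) (idx : Fin (n * m)), φ y idx = y (e.symm idx).1 (e.symm idx).2 := fun _ _ => rfl
  let blk : Fin (n * m) → Fin n := fun idx => (e.symm idx).1
  -- block sizes
  have hb : ∀ j : Fin n, bsize blk j = m := by
    intro j
    unfold bsize
    have hset : (Finset.univ.filter fun idx : Fin (n * m) => blk idx = j) =
        ((Finset.univ.filter fun p : Fin n × Fin m => p.1 = j).map e.toEmbedding) := by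
      ext idx
      simp only [Finset.mem_filter, Finset.mem_univ, true_and, Finset.mem_map, Equiv.coe_toEmbedding]
      constructor
      · intro hidx; exact ⟨e.symm idx, hidx, e.apply_symm_apply idx⟩
      · rintro ⟨p, hp, rfl⟩
        change (e.symm (e p)).1 = j
        rw [e.symm_apply_apply]; exact hp
    rw [hset, Finset.card_map]
    have hprod : (Finset.univ.filter fun p : Fin n × Fin m => p.1 = j) = ({j} : Finset (Fin n)) ×ˢ (Finset.univ : Finset (Fin m)) := by
      ext ⟨a, b⟩
      simp [eq_comm]
    rw [hprod, Finset.card_product, Finset.card_singleton, Finset.card_univ, Fintype.card_fin, one_mul]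
  -- zero counts
  have hz : ∀ j : Fin n, zcount blk j (Y.image fun y => φ y) = (Y.filter fun y => y j = 0).card := by
    intro j
    unfold zcount
    rw [Finset.filter_image, Finset.card_image_of_injective _ φ.injective]
    congr 1
    apply Finset.filter_congr
    intro y _
    constructor
    · intro hall
      funext i
      have hi := hall (e (j, i)) (by change (e.symm (e (j, i))).1 = j; rw [e.symm_apply_apply])
      rw [hφ] at hi
      rw [e.symm_apply_apply] at hi
      exact hi
    · intro hj idx hidx
      rw [hφ]
      have hidx' : (e.symm idx).1 = j := hidx
      rw [hidx', hj]
      rfl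
  -- the mixed certificate for `φ(Y)`
  have hU := h (n * m) n blk (Y.image fun y => φ y)
  unfold UCMix at hU
  rw [Finset.sum_image fun y _ z _ hyz => φ.injective hyz] at hU
  simp only [hb, hz] at hU
  -- compare termwise: `acodim (φ Y) (φ y) ≤ codim_Y y`
  refine le_trans (Finset.sum_le_sum fun y hy => ?_) hU
  have ha : (acodim (n * m) (Y.image fun z => φ z) (φ y) : ℤ) ≤
      ((sInf {c : ℕ | ∃ A : AffineSubspace (ZMod 2) (Fin n → Fin m → ZMod 2), y ∈ A ∧ (∀ z ∈ A, z ∈ Y) ∧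
        n * m ≤ Module.finrank (ZMod 2) A.direction + c} : ℕ) : ℤ) := by
    unfold acodim
    exact_mod_cast sInf_flatCodim_image_le φ Y hy (n * m)
  have hsum : ∑ j : Fin n, ((m : ℕ) - 1 : ℤ) = (n : ℤ) * ((m : ℤ) - 1) := by
    rw [Finset.sum_const, Finset.card_univ, Fintype.card_fin, nsmul_eq_mul]
  rw [hsum]
  push_cast
  linarith [ha]

end Summit.PneNP.PneNP.Theorems.ClusCoord
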